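import Summits.QuantumFields.BalabanUV.Beta.EriceFlowEnclosureB12AsPrintedHistoryContagionShiftFlowZeroClock
import Summits.QuantumFields.BalabanUV.Beta.EriceRemainderEnclosureHistoryAutonomyTwoLoopCoefficients

/-!
# Beta / EriceFlowEnclosureB12AsPrintedHistoryContagionShiftFlowZeroTwoLoop — ASYMPTOTIC FREEDOM IS CONTAGIOUS, part 39: THE TWO-LOOP LETTER WITH MEMORY AT THE ZERO
# HISTORY — AN ABSOLUTE TWO-LOOP Λ-PARAMETER FOR EVERY ASYMPTOTICALLY FREE TRAJECTORY.  Part 33: under a memory profile alone every AF trajectory obeys the one-loop law with a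
# square-root defect, and part 37: that defect is attained — an ABSOLUTE Λ needs more than the value β₀ at the zero history.  d4-p2's (E54a)
# `EriceRemainderEnclosureHistoryAutonomyTwoLoopLambda.exists_tendsto_twoLoopLambda` supplies the two-loop Λ under the MARKOV two-loop letter `|B(u) − (b₀ + b₁u(0)²)| ≤ ρ(a)`
# on the sub-boxes ]0, a]^ℕ with `Σ ρ(c_m) < ∞` — a shape that a functional with GENUINE two-loop memory (say `β₀ + u(1)²`, its g²-coefficient sitting one scale up) does NOT
# have: on ]0, a]^ℕ its best sub-box remainder is of order a², and `Σ_m a_m² = Σ_m 1∕m = ∞`.  THIS PART states the two-loop letter WITH MEMORY — HYPOTHESIS SHAPE (T2m):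
# **`|B(u) − β₀ − b₁·u(0)²| ≤ C₂·Σ_j θ^j·(u(j)⁴ + |u(j)² − u(0)²|)`** on the box (a fading g²-dependence on EVERY age, referred to the age-0 coupling, plus a quartic remainder) —
# and proves that it suffices ALONG TRAJECTORIES: an asymptotically free box solution t varies slowly in the ultraviolet (`|t(q+j)² − t(q)²| ≤ j·B̄·c_q⁴`, B̄ a bound of |B| on
# the box, c_q the tail scale), so the memory part of (T2m) is O(c⁴) scale by scale and summable; with part 33's one-loop law for the term `b₁·(t(m+1)² − 1∕(β₀(m+1)))` and
# d4-p2's harmonic-increment lemma for the logarithm, the TWO-LOOP SEQUENCE `E_m = 1∕t(m)² − m·β₀ − (b₁∕β₀)·log m` has increments `≤ K∕((m+1)√(m+1))`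
# (`abs_twoLoopSeq_succ_sub_le`), hence **CONVERGES** (`exists_twoLoopLambda`): **`1∕t(m)² = m·β₀ + (b₁∕β₀)·log m + Λ(t) + o(1)`** for EVERY AF box solution of EVERY
# fading-memory flow satisfying (T2m) — any box, any constants, NO smallness, NO floor — with the read-outs `1∕(m·t(m)²) → β₀`, `(1∕t(m)² − mβ₀)∕log m → b₁∕β₀` by d4-p2's
# (E54d) BY NAME (`twoLoop_readouts`).  The letter's constant is FORCED: any b₀ admissible in (T2m)'s place of β₀ equals the value at the zero history (`twoLoop_const_eq_valueAtZero`).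
# Abstract in B (β-flow team, prover 1, unit `b2b-balaban-beta-bflow-p1`, gen 39; ROW AP-I·Uc × ROW D4-AUTONOMY × ROW Λ — the two-loop letter with memory)

HONEST FRAMING (page 1 of everything the β sub-cell writes): discharging `BetaPertH` makes Bałaban's UV stability UNCONDITIONAL — a
real constructive-QFT result; it is NOT the continuum limit and NOT the Clay problem.  HONEST DEPENDENCY (cell reorg 2026-08-19,
verbatim): «continuum YM on T⁴ ⇐ BetaPertH ∧ nine spine estimates (0/9 proved); BetaPertH ⇐ (D1) ∧ (D4) ∧ CAP+tail; G-an2-4 gates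
asym, D1 and NE2/3/4.»  THIS MODULE DISCHARGES NOTHING: elementary real analysis (a telescoping estimate with a `p = 3∕2` majorant) over node U2's HYPOTHESIS SHAPES
`T4BetaStationary.{SeqBox, MemoryProfile}`, `T4BetaFlowWellPosed.MemFlow` on an ABSTRACT functional `B`; (T2m) is a HYPOTHESIS SHAPE introduced here as a displayed binder
(no definition); part 32's `abs_sub_valueAtZero_le ∕ tail_le_invSprof ∕ valueAtZero_pos`, part 33's `abs_invSq_sub_oneLoop_le`, d4-p2's (E54a) arithmetic
`one_div_sq_le_inv_mul_sqrt ∕ abs_inv_succ_sub_log_le ∕ summable_inv_mul_sqrt` and (E54d) `tendsto_inv_mul_sq ∕ tendsto_sub_linear_div_log`, Mathlib's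
`tsum_coe_mul_geometric_of_norm_lt_one`, node U2's `sprof` BY NAME — nothing restated.  Erice's (3.73) «β_n(g_n²) = β_{n,0} + β_{n,2}g_n² + O(g_n⁴)» (p. 250) is stated for the
LATTICE β-functions as functions of ONE coupling; its version for Bałaban's history-dependent functional — in particular the shape (T2m) — is NOT PRINTED ([I] p. 298; GAPS
G-t4-U2-1∕-2) and NOT asserted.  [I] = T. Bałaban, Commun. Math. Phys. **109** (1987) 249–301 [Balaban1987RG1].

WHAT THIS FILE PROVES (0 sorry, 0 def): §62 `abs_le_of_valueAtZero` (|B| ≤ B̄ on the box), `abs_invSq_shift_le` (`|1∕t(q+j)² − 1∕t(q)²| ≤ j·B̄`), `abs_sq_shift_le` (slow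
variation `≤ j·B̄·c_q⁴`), `tsum_twoLoopWeight_le`, **`abs_twoLoop_remainder_le`** ((T2m) along the trajectory is O(c⁴)), `sprof_le_add`, `abs_sq_sub_inv_le` (the b₁-term against
`1∕(β₀(m+1))` by part 33), **`abs_twoLoopSeq_succ_sub_le`**, **`exists_twoLoopLambda`**, `twoLoop_readouts`, **`twoLoop_const_eq_valueAtZero`**.  NOT CLAIMED: the dependence of
Λ on the pin (d4-p2's (E54) Pin row is the floored precedent; near zero pin it follows with parts 34–35 — successor); anything about Bałaban's β; `BetaPertH`; continuum; Clay.
-/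

namespace Summit.QuantumFields.BalabanUV.Beta.EriceFlowEnclosureB12AsPrintedHistoryContagionShiftFlowZeroTwoLoop

open Finset Filter Topology
open Literature.MathematicalPhysics.QuantumFieldTheory.Balaban1983to89
open Literature.MathematicalPhysics.QuantumFieldTheory.Balaban1983to89.T4CouplingMatching (prof sprof sprof_pos sprof_sq prof_pos)
open Literature.MathematicalPhysics.QuantumFieldTheory.Balaban1983to89.T4BetaStationary (SeqBox MemoryProfile)
open Literature.MathematicalPhysics.QuantumFieldTheory.Balaban1983to89.T4BetaStationary.Probes (summable_weighted)
open Literature.MathematicalPhysics.QuantumFieldTheory.Balaban1983to89.T4BetaFlowWellPosed (MemFlow seqBox_shift)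
open Summit.QuantumFields.BalabanUV.Beta.EriceFlowEnclosureB12AsPrintedHistoryContagionShiftFlowRepinTail (one_div_sprof_pos invSq_one_div_sprof)
open Summit.QuantumFields.BalabanUV.Beta.EriceFlowEnclosureB12AsPrintedHistoryContagionShiftFlowZero (abs_sub_valueAtZero_le tail_le_invSprof valueAtZero_pos)
open Summit.QuantumFields.BalabanUV.Beta.EriceFlowEnclosureB12AsPrintedHistoryContagionShiftFlowZeroClock (abs_invSq_sub_oneLoop_le)
open Summit.QuantumFields.BalabanUV.Beta.EriceRemainderEnclosureHistoryAutonomyTwoLoopLambda (one_div_sq_le_inv_mul_sqrt abs_inv_succ_sub_log_le summable_inv_mul_sqrt)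
open Summit.QuantumFields.BalabanUV.Beta.EriceRemainderEnclosureHistoryAutonomyTwoLoopCoefficients (tendsto_inv_mul_sq tendsto_sub_linear_div_log)

noncomputable section

/-! ## §62 Slow variation along the trajectory, the two-loop remainder, the two-loop sequence -/

/-- A functional with the value β₀ at the zero history is BOUNDED on the box: `|B u| ≤ |β₀| + C_m γ∕(1 − θ)`. [folklore] -/
theorem abs_le_of_valueAtZero {B : (ℕ → ℝ) → ℝ} {Cm θ γ β₀ : ℝ} {u : ℕ → ℝ} (hCm : 0 ≤ Cm) (hθ0 : 0 ≤ θ) (hθ1 : θ < 1)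
    (h0 : ∀ u : ℕ → ℝ, SeqBox γ u → |B u - β₀| ≤ Cm * ∑' j, θ ^ j * u j) (hu : SeqBox γ u) :
    |B u| ≤ |β₀| + Cm * γ / (1 - θ) := by
  have h := abs_sub_valueAtZero_le (a := γ) hCm hθ0 hθ1 h0 hu (fun j => (hu j).2)
  calc |B u| = |(B u - β₀) + β₀| := by ring_nf
    _ ≤ |B u - β₀| + |β₀| := abs_add_le _ _
    _ ≤ _ := by linarith

/-- **THE CHART MOVES AT BOUNDED SPEED**: a box solution t of `MemFlow B g* t` has `|1∕t(q+j)² − 1∕t(q)²| ≤ j·B̄`, `B̄ = |β₀| + C_m γ∕(1 − θ)`. [folklore] -/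
theorem abs_invSq_shift_le {B : (ℕ → ℝ) → ℝ} {Cm θ γ β₀ gs : ℝ} {t : ℕ → ℝ} (hCm : 0 ≤ Cm) (hθ0 : 0 ≤ θ) (hθ1 : θ < 1)
    (h0 : ∀ u : ℕ → ℝ, SeqBox γ u → |B u - β₀| ≤ Cm * ∑' j, θ ^ j * u j) (hts : SeqBox γ t) (htf : MemFlow B gs t) (q j : ℕ) :
    |1 / t (q + j) ^ 2 - 1 / t q ^ 2| ≤ (j : ℝ) * (|β₀| + Cm * γ / (1 - θ)) := by
  induction j with
  | zero => simp
  | succ j ih =>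
    have hstep := abs_le_of_valueAtZero hCm hθ0 hθ1 h0 (seqBox_shift hts (q + j + 1))
    have e : 1 / t (q + (j + 1)) ^ 2 - 1 / t q ^ 2 = (1 / t (q + j) ^ 2 - 1 / t q ^ 2) + B (fun i => t (q + j + 1 + i)) := by
      rw [show q + (j + 1) = q + j + 1 by omega, htf.2 (q + j)]; ring
    rw [e]
    refine (abs_add_le _ _).trans ?_
    push_cast
    linarith

/-- **SLOW VARIATION OF THE RUNNING COUPLING IN THE ULTRAVIOLET**: if the tail beyond scale q lies below c (`t(q+i) ≤ c`), then `|t(q+j)² − t(q)²| ≤ j·B̄·c⁴`. [folklore] -/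
theorem abs_sq_shift_le {B : (ℕ → ℝ) → ℝ} {Cm θ γ β₀ gs c : ℝ} {t : ℕ → ℝ} (hCm : 0 ≤ Cm) (hθ0 : 0 ≤ θ) (hθ1 : θ < 1)
    (h0 : ∀ u : ℕ → ℝ, SeqBox γ u → |B u - β₀| ≤ Cm * ∑' j, θ ^ j * u j) (hts : SeqBox γ t) (htf : MemFlow B gs t) (q : ℕ)
    (hc : ∀ i, t (q + i) ≤ c) (j : ℕ) :
    |t (q + j) ^ 2 - t q ^ 2| ≤ (j : ℝ) * (|β₀| + Cm * γ / (1 - θ)) * c ^ 4 := by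
  have ha := (hts (q + j)).1
  have hb := (hts q).1
  have hac : t (q + j) ≤ c := hc j
  have hbc : t q ≤ c := by simpa using hc 0
  have hD := abs_invSq_shift_le hCm hθ0 hθ1 h0 hts htf q j
  have e : t (q + j) ^ 2 - t q ^ 2 = (t (q + j) ^ 2 * t q ^ 2) * (1 / t q ^ 2 - 1 / t (q + j) ^ 2) := by
    field_simp
  rw [e, abs_mul, abs_of_pos (by positivity), abs_sub_comm]
  have h4 : t (q + j) ^ 2 * t q ^ 2 ≤ c ^ 4 := by
    calc t (q + j) ^ 2 * t q ^ 2 ≤ c ^ 2 * c ^ 2 :=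
          mul_le_mul (pow_le_pow_left₀ ha.le hac 2) (pow_le_pow_left₀ hb.le hbc 2) (by positivity) (by positivity)
      _ = c ^ 4 := by ring
  calc t (q + j) ^ 2 * t q ^ 2 * |1 / t (q + j) ^ 2 - 1 / t q ^ 2| ≤ c ^ 4 * ((j : ℝ) * (|β₀| + Cm * γ / (1 - θ))) :=
        mul_le_mul h4 hD (abs_nonneg _) (by positivity)
    _ = _ := by ring

/-- The (T2m) weight of a tail below c that varies slowly: `Σ_j θ^j (u_j⁴ + |u_j² − u_0²|) ≤ c⁴∕(1 − θ) + B̄c⁴·θ∕(1 − θ)²` (`Σ j θ^j = θ∕(1 − θ)²`). [folklore] -/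
theorem tsum_twoLoopWeight_le {θ c Bbar : ℝ} {u : ℕ → ℝ} (hθ0 : 0 ≤ θ) (hθ1 : θ < 1)
    (hpos : ∀ j, 0 < u j) (hu : ∀ j, u j ≤ c) (hvar : ∀ j, |u j ^ 2 - u 0 ^ 2| ≤ (j : ℝ) * Bbar * c ^ 4) :
    ∑' j, θ ^ j * (u j ^ 4 + |u j ^ 2 - u 0 ^ 2|) ≤ c ^ 4 / (1 - θ) + Bbar * c ^ 4 * (θ / (1 - θ) ^ 2) := by
  have hnorm : ‖θ‖ < 1 := by rw [Real.norm_eq_abs, abs_of_nonneg hθ0]; exact hθ1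
  have hg : Summable fun j : ℕ => θ ^ j * c ^ 4 := (summable_geometric_of_lt_one hθ0 hθ1).mul_right _
  have hj : Summable fun j : ℕ => (j : ℝ) * θ ^ j := by
    simpa using summable_pow_mul_geometric_of_norm_lt_one 1 hnorm
  have hj' : Summable fun j : ℕ => (j : ℝ) * θ ^ j * (Bbar * c ^ 4) := hj.mul_right _
  have hmaj : Summable fun j : ℕ => θ ^ j * c ^ 4 + (j : ℝ) * θ ^ j * (Bbar * c ^ 4) := hg.add hj'
  have hpt : ∀ j : ℕ, θ ^ j * (u j ^ 4 + |u j ^ 2 - u 0 ^ 2|) ≤ θ ^ j * c ^ 4 + (j : ℝ) * θ ^ j * (Bbar * c ^ 4) := by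
    intro j
    have h1 : u j ^ 4 ≤ c ^ 4 := pow_le_pow_left₀ (hpos j).le (hu j) 4
    have h2 := hvar j
    have hθj := pow_nonneg hθ0 j
    nlinarith [mul_le_mul_of_nonneg_left (add_le_add h1 h2) hθj]
  have hs : Summable fun j : ℕ => θ ^ j * (u j ^ 4 + |u j ^ 2 - u 0 ^ 2|) :=
    Summable.of_nonneg_of_le (fun j => mul_nonneg (pow_nonneg hθ0 j) (by positivity)) hpt hmaj
  calc ∑' j, θ ^ j * (u j ^ 4 + |u j ^ 2 - u 0 ^ 2|) ≤ ∑' j : ℕ, (θ ^ j * c ^ 4 + (j : ℝ) * θ ^ j * (Bbar * c ^ 4)) := hs.tsum_le_tsum hpt hmaj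
    _ = (∑' j : ℕ, θ ^ j) * c ^ 4 + (∑' j : ℕ, (j : ℝ) * θ ^ j) * (Bbar * c ^ 4) := by
        rw [hg.tsum_add hj', tsum_mul_right, tsum_mul_right]
    _ = c ^ 4 / (1 - θ) + Bbar * c ^ 4 * (θ / (1 - θ) ^ 2) := by
        rw [tsum_geometric_of_lt_one hθ0 hθ1, tsum_coe_mul_geometric_of_norm_lt_one hnorm]; ring

/-- **THE TWO-LOOP LETTER WITH MEMORY IS O(c⁴) ALONG AN ASYMPTOTICALLY FREE TRAJECTORY.**  `B` with the value β₀ at the zero history (modulus `C_m·Σθ^j u_j`) and the TWO-LOOP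
LETTER WITH MEMORY (T2m) `|B(u) − β₀ − b₁u(0)²| ≤ C₂·Σ_j θ^j (u(j)⁴ + |u(j)² − u(0)²|)` on the box; t an AF box solution (`1∕t_a² + β*·m ≤ 1∕t(m)²`).  THEN at every scale m:
**`|B(t(m+1+·)) − β₀ − b₁·t(m+1)²| ≤ C₂·(1∕(1 − θ) + B̄θ∕(1 − θ)²)·c_{m+1}⁴`**, `c_q = (1∕t_a² + β*q)^{−1∕2}`, `B̄ = |β₀| + C_mγ∕(1 − θ)` — the memory in the g²-term
costs only O(g⁴) along the trajectory because the running coupling varies slowly in the ultraviolet. [cite: Balaban1987RG1, Thm 2 (0.31) p.259 with (0.20) p.256 and p.298] -/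
theorem abs_twoLoop_remainder_le {B : (ℕ → ℝ) → ℝ} {Cm θ γ β₀ b₁ C₂ bs ta gs : ℝ} {t : ℕ → ℝ} (hCm : 0 ≤ Cm) (hθ0 : 0 ≤ θ) (hθ1 : θ < 1) (hC₂ : 0 ≤ C₂)
    (hbs : 0 < bs) (hta : 0 < ta)
    (h0 : ∀ u : ℕ → ℝ, SeqBox γ u → |B u - β₀| ≤ Cm * ∑' j, θ ^ j * u j)
    (h2 : ∀ u : ℕ → ℝ, SeqBox γ u → |B u - β₀ - b₁ * u 0 ^ 2| ≤ C₂ * ∑' j, θ ^ j * (u j ^ 4 + |u j ^ 2 - u 0 ^ 2|))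
    (hts : SeqBox γ t) (htf : MemFlow B gs t) (hprof : ∀ m : ℕ, 1 / ta ^ 2 + bs * (m : ℝ) ≤ 1 / (t m) ^ 2) (m : ℕ) :
    |B (fun j => t (m + 1 + j)) - β₀ - b₁ * t (m + 1) ^ 2|
      ≤ C₂ * (1 / (1 - θ) + (|β₀| + Cm * γ / (1 - θ)) * (θ / (1 - θ) ^ 2)) * (1 / sprof ta bs (m + 1)) ^ 4 := by
  have h1θ : 0 < 1 - θ := by linarith
  have hγ : 0 ≤ γ := ((hts 0).1.le).trans (hts 0).2
  set c : ℝ := 1 / sprof ta bs (m + 1) with hc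
  have hc0 : 0 < c := one_div_sprof_pos hta hbs.le (m + 1)
  have hBbar : 0 ≤ |β₀| + Cm * γ / (1 - θ) := by positivity
  have htail : ∀ i, t (m + 1 + i) ≤ c := fun i => tail_le_invSprof hta hbs.le (fun q => (hts q).1) hprof (m + 1) i
  have hvar : ∀ j, |t (m + 1 + j) ^ 2 - t (m + 1 + 0) ^ 2| ≤ (j : ℝ) * (|β₀| + Cm * γ / (1 - θ)) * c ^ 4 := fun j => by
    rw [Nat.add_zero]; exact abs_sq_shift_le hCm hθ0 hθ1 h0 hts htf (m + 1) htail j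
  have hw := tsum_twoLoopWeight_le (u := fun j => t (m + 1 + j)) hθ0 hθ1 (fun j => (hts (m + 1 + j)).1) htail hvar
  have h := h2 _ (seqBox_shift hts (m + 1))
  simp only [Nat.add_zero] at h hw
  calc |B (fun j => t (m + 1 + j)) - β₀ - b₁ * t (m + 1) ^ 2| ≤ C₂ * ∑' j, θ ^ j * (t (m + 1 + j) ^ 4 + |t (m + 1 + j) ^ 2 - t (m + 1) ^ 2|) := h
    _ ≤ C₂ * (c ^ 4 / (1 - θ) + (|β₀| + Cm * γ / (1 - θ)) * c ^ 4 * (θ / (1 - θ) ^ 2)) := mul_le_mul_of_nonneg_left hw hC₂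
    _ = _ := by ring

/-- `√(1∕t_a² + β*n) ≤ 1∕t_a + √β*·√n`. [folklore] -/
theorem sprof_le_add {ta bs : ℝ} (hta : 0 < ta) (hbs : 0 ≤ bs) (n : ℕ) : sprof ta bs n ≤ 1 / ta + Real.sqrt bs * Real.sqrt n := by
  have hx : 0 ≤ 1 / ta + Real.sqrt bs * Real.sqrt n := by positivity
  unfold T4CouplingMatching.sprof T4CouplingMatching.prof
  rw [Real.sqrt_le_left hx]
  have e : (1 / ta + Real.sqrt bs * Real.sqrt n) ^ 2 = 1 / ta ^ 2 + bs * n + 2 * (1 / ta) * (Real.sqrt bs * Real.sqrt n) := by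
    rw [add_sq, mul_pow, Real.sq_sqrt hbs, Real.sq_sqrt (Nat.cast_nonneg n)]; ring
  rw [e]
  have : 0 ≤ 2 * (1 / ta) * (Real.sqrt bs * Real.sqrt n) := by positivity
  linarith

/-- **THE b₁-TERM AGAINST ITS REFERENCE VALUE**: for an AF box solution (value β₀ > 0 at zero, profile `(t_a, β*)`),
`|t(m+1)² − 1∕(β₀(m+1))| ≤ (1∕g*² + (2C_m∕((1 − θ)β*))·√(1∕t_a² + β*(m+1)))∕(β*·β₀·(m+1)²)` (part 33's one-loop law in the numerator, the profile in the denominator). [folklore] -/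
theorem abs_sq_sub_inv_le {B : (ℕ → ℝ) → ℝ} {Cm θ γ β₀ bs ta gs : ℝ} {t : ℕ → ℝ} (hCm : 0 ≤ Cm) (hθ0 : 0 ≤ θ) (hθ1 : θ < 1) (hbs : 0 < bs) (hta : 0 < ta)
    (h0 : ∀ u : ℕ → ℝ, SeqBox γ u → |B u - β₀| ≤ Cm * ∑' j, θ ^ j * u j)
    (hts : SeqBox γ t) (htf : MemFlow B gs t) (hprof : ∀ m : ℕ, 1 / ta ^ 2 + bs * (m : ℝ) ≤ 1 / (t m) ^ 2) (m : ℕ) :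
    |t (m + 1) ^ 2 - 1 / (β₀ * ((m : ℝ) + 1))|
      ≤ (1 / gs ^ 2 + 2 * Cm / ((1 - θ) * bs) * sprof ta bs (m + 1)) / (bs * β₀ * ((m : ℝ) + 1) ^ 2) := by
  have h1θ : 0 < 1 - θ := by linarith
  have hβ₀ := valueAtZero_pos hCm hθ0 hθ1 hbs hta h0 hts htf hprof
  set A : ℝ := 1 / t (m + 1) ^ 2 with hA
  set D : ℝ := β₀ * ((m : ℝ) + 1) with hD
  have hpos := (hts (m + 1)).1
  have hm1 : (0 : ℝ) < (m : ℝ) + 1 := by positivity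
  have hAlow : bs * ((m : ℝ) + 1) ≤ A := by
    have := hprof (m + 1); push_cast at this
    have : (0 : ℝ) ≤ 1 / ta ^ 2 := by positivity
    rw [hA]; linarith
  have hA0 : 0 < A := lt_of_lt_of_le (by positivity) hAlow
  have hD0 : 0 < D := by positivity
  have hnum : |D - A| ≤ 1 / gs ^ 2 + 2 * Cm / ((1 - θ) * bs) * sprof ta bs (m + 1) := by
    have h := abs_invSq_sub_oneLoop_le hCm hθ0 hθ1 hbs hta h0 hts htf hprof (m + 1)
    push_cast at h
    have e : D - A = -(1 / t (m + 1) ^ 2 - 1 / gs ^ 2 - ((m : ℝ) + 1) * β₀) - 1 / gs ^ 2 := by rw [hA, hD]; ring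
    rw [e]
    refine (abs_sub _ _).trans ?_
    rw [abs_neg, abs_of_nonneg (by positivity : (0 : ℝ) ≤ 1 / gs ^ 2)]
    linarith
  have hsq : t (m + 1) ^ 2 = 1 / A := by rw [hA, one_div_one_div]
  have e : 1 / A - 1 / D = (D - A) / (A * D) := by field_simp
  have hden : bs * β₀ * ((m : ℝ) + 1) ^ 2 ≤ A * D := by
    have : bs * β₀ * ((m : ℝ) + 1) ^ 2 = (bs * ((m : ℝ) + 1)) * (β₀ * ((m : ℝ) + 1)) := by ring
    rw [this]
    exact mul_le_mul_of_nonneg_right hAlow hD0.le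
  have hsp := sprof_pos hta hbs.le (m + 1)
  have hN0 : 0 ≤ 1 / gs ^ 2 + 2 * Cm / ((1 - θ) * bs) * sprof ta bs (m + 1) := add_nonneg (by positivity) (mul_nonneg (by positivity) hsp.le)
  rw [hsq, show 1 / (β₀ * ((m : ℝ) + 1)) = 1 / D by rw [hD], e, abs_div, abs_of_pos (mul_pos hA0 hD0)]
  exact div_le_div₀ hN0 hnum (by positivity) hden

/-- **THE INCREMENTS OF THE TWO-LOOP SEQUENCE ARE SUMMABLY SMALL.**  Under the value-at-zero letter, (T2m) and an AF profile, the two-loop sequence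
`E_m = 1∕t(m)² − m·β₀ − (b₁∕β₀)·log m` satisfies **`|E_{m+1} − E_m| ≤ K∕((m+1)√(m+1))`** with the explicit constant
`K = C₂(1∕(1−θ) + B̄θ∕(1−θ)²)∕β*² + |b₁|·(1∕g*² + (2C_m∕((1−θ)β*))(1∕t_a + √β*))∕(β*β₀) + 2|b₁|∕β₀` — memory remainder O(c⁴) + the b₁-term against `1∕(β₀(m+1))` (part 33) +
d4-p2's harmonic increment of the logarithm. [cite: Balaban1987RG1, Thm 2 (0.31) p.259 with (0.20) p.256 and p.298] -/
theorem abs_twoLoopSeq_succ_sub_le {B : (ℕ → ℝ) → ℝ} {Cm θ γ β₀ b₁ C₂ bs ta gs : ℝ} {t : ℕ → ℝ} (hCm : 0 ≤ Cm) (hθ0 : 0 ≤ θ) (hθ1 : θ < 1) (hC₂ : 0 ≤ C₂)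
    (hbs : 0 < bs) (hta : 0 < ta)
    (h0 : ∀ u : ℕ → ℝ, SeqBox γ u → |B u - β₀| ≤ Cm * ∑' j, θ ^ j * u j)
    (h2 : ∀ u : ℕ → ℝ, SeqBox γ u → |B u - β₀ - b₁ * u 0 ^ 2| ≤ C₂ * ∑' j, θ ^ j * (u j ^ 4 + |u j ^ 2 - u 0 ^ 2|))
    (hts : SeqBox γ t) (htf : MemFlow B gs t) (hprof : ∀ m : ℕ, 1 / ta ^ 2 + bs * (m : ℝ) ≤ 1 / (t m) ^ 2) (m : ℕ) :
    |(1 / t (m + 1) ^ 2 - ((m : ℝ) + 1) * β₀ - b₁ / β₀ * Real.log ((m : ℝ) + 1)) - (1 / t m ^ 2 - (m : ℝ) * β₀ - b₁ / β₀ * Real.log (m : ℝ))|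
      ≤ (C₂ * (1 / (1 - θ) + (|β₀| + Cm * γ / (1 - θ)) * (θ / (1 - θ) ^ 2)) / bs ^ 2
          + |b₁| * ((1 / gs ^ 2 + 2 * Cm / ((1 - θ) * bs) * (1 / ta + Real.sqrt bs)) / (bs * β₀)) + 2 * |b₁| / β₀)
        * (1 / (((m : ℝ) + 1) * Real.sqrt ((m : ℝ) + 1))) := by
  have h1θ : 0 < 1 - θ := by linarith
  have hγ : 0 ≤ γ := ((hts 0).1.le).trans (hts 0).2
  have hβ₀ := valueAtZero_pos hCm hθ0 hθ1 hbs hta h0 hts htf hprof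
  have hm1 : (0 : ℝ) < (m : ℝ) + 1 := by positivity
  have hsq1 : 0 < Real.sqrt ((m : ℝ) + 1) := Real.sqrt_pos.2 hm1
  have hs1le : 1 ≤ Real.sqrt ((m : ℝ) + 1) := by
    have h := Real.sqrt_le_sqrt (show (1 : ℝ) ≤ (m : ℝ) + 1 by linarith [(Nat.cast_nonneg m : (0 : ℝ) ≤ m)])
    rwa [Real.sqrt_one] at h
  set g : ℝ := 1 / (((m : ℝ) + 1) * Real.sqrt ((m : ℝ) + 1)) with hg
  have hg0 : 0 < g := by rw [hg]; positivity
  set M₁ : ℝ := C₂ * (1 / (1 - θ) + (|β₀| + Cm * γ / (1 - θ)) * (θ / (1 - θ) ^ 2)) with hM₁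
  have hM₁0 : 0 ≤ M₁ := by positivity
  -- the decomposition of the increment
  have e : (1 / t (m + 1) ^ 2 - ((m : ℝ) + 1) * β₀ - b₁ / β₀ * Real.log ((m : ℝ) + 1)) - (1 / t m ^ 2 - (m : ℝ) * β₀ - b₁ / β₀ * Real.log (m : ℝ))
      = (B (fun j => t (m + 1 + j)) - β₀ - b₁ * t (m + 1) ^ 2) + b₁ * (t (m + 1) ^ 2 - 1 / (β₀ * ((m : ℝ) + 1)))
        + b₁ / β₀ * (1 / ((m : ℝ) + 1) - (Real.log ((m : ℝ) + 1) - Real.log (m : ℝ))) := by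
    rw [htf.2 m]; field_simp; ring
  rw [e]
  -- (1) the memory remainder is O(c⁴) and c⁴ ≤ 1∕(β*²(m+1)²) ≤ (1∕β*²)·g
  have hc4 : (1 / sprof ta bs (m + 1)) ^ 4 ≤ 1 / bs ^ 2 * g := by
    have hx : bs * ((m : ℝ) + 1) ≤ prof ta bs (m + 1) := by
      unfold T4CouplingMatching.prof; push_cast
      have : (0 : ℝ) ≤ 1 / ta ^ 2 := by positivity
      linarith
    have hx0 : 0 < bs * ((m : ℝ) + 1) := by positivity
    have e4 : (1 / sprof ta bs (m + 1)) ^ 4 = 1 / (prof ta bs (m + 1)) ^ 2 := by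
      rw [show (4 : ℕ) = 2 * 2 from rfl, pow_mul, one_div_pow, sprof_sq hta hbs.le, one_div_pow]
    rw [e4]
    calc 1 / prof ta bs (m + 1) ^ 2 ≤ 1 / (bs * ((m : ℝ) + 1)) ^ 2 :=
          one_div_le_one_div_of_le (by positivity) (pow_le_pow_left₀ hx0.le hx 2)
      _ = 1 / bs ^ 2 * (1 / ((m : ℝ) + 1) ^ 2) := by field_simp
      _ ≤ 1 / bs ^ 2 * g := mul_le_mul_of_nonneg_left (one_div_sq_le_inv_mul_sqrt m) (by positivity)
  have hT1 : |B (fun j => t (m + 1 + j)) - β₀ - b₁ * t (m + 1) ^ 2| ≤ M₁ / bs ^ 2 * g := by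
    have h := abs_twoLoop_remainder_le hCm hθ0 hθ1 hC₂ hbs hta h0 h2 hts htf hprof m
    calc _ ≤ M₁ * (1 / sprof ta bs (m + 1)) ^ 4 := h
      _ ≤ M₁ * (1 / bs ^ 2 * g) := mul_le_mul_of_nonneg_left hc4 hM₁0
      _ = M₁ / bs ^ 2 * g := by ring
  -- (2) the b₁-term
  have hT2 : |b₁ * (t (m + 1) ^ 2 - 1 / (β₀ * ((m : ℝ) + 1)))|
      ≤ |b₁| * ((1 / gs ^ 2 + 2 * Cm / ((1 - θ) * bs) * (1 / ta + Real.sqrt bs)) / (bs * β₀) * g) := by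
    rw [abs_mul]
    have h := abs_sq_sub_inv_le hCm hθ0 hθ1 hbs hta h0 hts htf hprof m
    have hK₁ : 0 ≤ 2 * Cm / ((1 - θ) * bs) := by positivity
    have hsp : sprof ta bs (m + 1) ≤ (1 / ta + Real.sqrt bs) * Real.sqrt ((m : ℝ) + 1) := by
      have h1 := sprof_le_add hta hbs.le (m + 1)
      push_cast at h1
      have : 1 / ta ≤ 1 / ta * Real.sqrt ((m : ℝ) + 1) := le_mul_of_one_le_right (by positivity) hs1le
      nlinarith [Real.sqrt_nonneg bs]
    have hnum : 1 / gs ^ 2 + 2 * Cm / ((1 - θ) * bs) * sprof ta bs (m + 1)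
        ≤ (1 / gs ^ 2 + 2 * Cm / ((1 - θ) * bs) * (1 / ta + Real.sqrt bs)) * Real.sqrt ((m : ℝ) + 1) := by
      have : 1 / gs ^ 2 ≤ 1 / gs ^ 2 * Real.sqrt ((m : ℝ) + 1) := le_mul_of_one_le_right (by positivity) hs1le
      nlinarith [mul_le_mul_of_nonneg_left hsp hK₁]
    have hstep : |t (m + 1) ^ 2 - 1 / (β₀ * ((m : ℝ) + 1))|
        ≤ (1 / gs ^ 2 + 2 * Cm / ((1 - θ) * bs) * (1 / ta + Real.sqrt bs)) / (bs * β₀) * g := by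
      refine h.trans ?_
      rw [div_le_iff₀ (by positivity)]
      have eg : (1 / gs ^ 2 + 2 * Cm / ((1 - θ) * bs) * (1 / ta + Real.sqrt bs)) / (bs * β₀) * g * (bs * β₀ * ((m : ℝ) + 1) ^ 2)
          = (1 / gs ^ 2 + 2 * Cm / ((1 - θ) * bs) * (1 / ta + Real.sqrt bs)) * Real.sqrt ((m : ℝ) + 1)
            * (((m : ℝ) + 1) / (Real.sqrt ((m : ℝ) + 1) * Real.sqrt ((m : ℝ) + 1))) := by
        rw [hg]; field_simp
      rw [eg, Real.mul_self_sqrt hm1.le, div_self hm1.ne', mul_one]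
      exact hnum
    exact mul_le_mul_of_nonneg_left hstep (abs_nonneg _)
  -- (3) the logarithm
  have hT3 : |b₁ / β₀ * (1 / ((m : ℝ) + 1) - (Real.log ((m : ℝ) + 1) - Real.log (m : ℝ)))| ≤ 2 * |b₁| / β₀ * g := by
    rw [abs_mul, abs_div, abs_of_pos hβ₀]
    have h := abs_inv_succ_sub_log_le m
    have h2 : 2 / ((m : ℝ) + 1) ^ 2 ≤ 2 * g := by
      have := one_div_sq_le_inv_mul_sqrt m
      rw [hg]; rw [div_eq_mul_one_div]; linarith
    calc |b₁| / β₀ * |1 / ((m : ℝ) + 1) - (Real.log ((m : ℝ) + 1) - Real.log (m : ℝ))| ≤ |b₁| / β₀ * (2 * g) :=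
          mul_le_mul_of_nonneg_left (h.trans h2) (by positivity)
      _ = 2 * |b₁| / β₀ * g := by ring
  calc _ ≤ |B (fun j => t (m + 1 + j)) - β₀ - b₁ * t (m + 1) ^ 2| + |b₁ * (t (m + 1) ^ 2 - 1 / (β₀ * ((m : ℝ) + 1)))|
        + |b₁ / β₀ * (1 / ((m : ℝ) + 1) - (Real.log ((m : ℝ) + 1) - Real.log (m : ℝ)))| := abs_add_three _ _ _
    _ ≤ M₁ / bs ^ 2 * g + |b₁| * ((1 / gs ^ 2 + 2 * Cm / ((1 - θ) * bs) * (1 / ta + Real.sqrt bs)) / (bs * β₀) * g) + 2 * |b₁| / β₀ * g :=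
        add_le_add (add_le_add hT1 hT2) hT3
    _ = _ := by rw [hM₁]; ring

/-- **AN ABSOLUTE TWO-LOOP Λ-PARAMETER FOR EVERY ASYMPTOTICALLY FREE TRAJECTORY OF A FLOW WITH TWO-LOOP MEMORY.**  `B` with the value β₀ at the zero history (modulus
`C_m·Σθ^j u_j`, C_m ≥ 0, 0 ≤ θ < 1) AND the two-loop letter with memory (T2m) `|B(u) − β₀ − b₁u(0)²| ≤ C₂·Σ_j θ^j (u(j)⁴ + |u(j)² − u(0)²|)` on a box of ANY size; ANY box
solution t of `MemFlow B g* t` with an AF profile `1∕t_a² + β*·m ≤ 1∕t(m)²` (β* > 0; NO smallness, NO floor).  THEN the two-loop sequence CONVERGES: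
**`1∕t(m)² − m·β₀ − (b₁∕β₀)·log m → Λ(t)`** — i.e. `1∕t(m)² = m·β₀ + (b₁∕β₀) log m + Λ + o(1)`: the trajectory has an ABSOLUTE two-loop Λ-parameter (summable increments,
`abs_twoLoopSeq_succ_sub_le` + d4-p2's `summable_inv_mul_sqrt`).  d4-p2's (E54a) is the floored Markov-letter precedent (`b₀ + b₁u(0)²` with a sub-box remainder).
[cite: Balaban1987RG1, Thm 2 (0.31) p.259 with (0.20) p.256 and p.298] -/
theorem exists_twoLoopLambda {B : (ℕ → ℝ) → ℝ} {Cm θ γ β₀ b₁ C₂ bs ta gs : ℝ} {t : ℕ → ℝ} (hCm : 0 ≤ Cm) (hθ0 : 0 ≤ θ) (hθ1 : θ < 1) (hC₂ : 0 ≤ C₂)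
    (hbs : 0 < bs) (hta : 0 < ta)
    (h0 : ∀ u : ℕ → ℝ, SeqBox γ u → |B u - β₀| ≤ Cm * ∑' j, θ ^ j * u j)
    (h2 : ∀ u : ℕ → ℝ, SeqBox γ u → |B u - β₀ - b₁ * u 0 ^ 2| ≤ C₂ * ∑' j, θ ^ j * (u j ^ 4 + |u j ^ 2 - u 0 ^ 2|))
    (hts : SeqBox γ t) (htf : MemFlow B gs t) (hprof : ∀ m : ℕ, 1 / ta ^ 2 + bs * (m : ℝ) ≤ 1 / (t m) ^ 2) :
    ∃ Λ : ℝ, Tendsto (fun m : ℕ => 1 / t m ^ 2 - (m : ℝ) * β₀ - b₁ / β₀ * Real.log (m : ℝ)) atTop (𝓝 Λ) := by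
  set K : ℝ := C₂ * (1 / (1 - θ) + (|β₀| + Cm * γ / (1 - θ)) * (θ / (1 - θ) ^ 2)) / bs ^ 2
      + |b₁| * ((1 / gs ^ 2 + 2 * Cm / ((1 - θ) * bs) * (1 / ta + Real.sqrt bs)) / (bs * β₀)) + 2 * |b₁| / β₀ with hK
  have hcauchy : CauchySeq fun m : ℕ => 1 / t m ^ 2 - (m : ℝ) * β₀ - b₁ / β₀ * Real.log (m : ℝ) := by
    refine cauchySeq_of_dist_le_of_summable _ (fun m => ?_) (summable_inv_mul_sqrt.mul_left K)
    rw [Real.dist_eq, abs_sub_comm]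
    have h := abs_twoLoopSeq_succ_sub_le hCm hθ0 hθ1 hC₂ hbs hta h0 h2 hts htf hprof m
    push_cast
    exact h
  exact cauchySeq_tendsto_of_complete hcauchy

/-- **THE READ-OUTS** (d4-p2's (E54d) BY NAME): under the data of `exists_twoLoopLambda`, `1∕(m·t(m)²) → β₀` and `(1∕t(m)² − m·β₀)∕log m → b₁∕β₀` — the one- and two-loop
coefficients are read off ANY single asymptotically free trajectory. [cite: Balaban1987RG1, Thm 2 (0.31) p.259 with (0.20) p.256 and p.298] -/
theorem twoLoop_readouts {B : (ℕ → ℝ) → ℝ} {Cm θ γ β₀ b₁ C₂ bs ta gs : ℝ} {t : ℕ → ℝ} (hCm : 0 ≤ Cm) (hθ0 : 0 ≤ θ) (hθ1 : θ < 1) (hC₂ : 0 ≤ C₂)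
    (hbs : 0 < bs) (hta : 0 < ta)
    (h0 : ∀ u : ℕ → ℝ, SeqBox γ u → |B u - β₀| ≤ Cm * ∑' j, θ ^ j * u j)
    (h2 : ∀ u : ℕ → ℝ, SeqBox γ u → |B u - β₀ - b₁ * u 0 ^ 2| ≤ C₂ * ∑' j, θ ^ j * (u j ^ 4 + |u j ^ 2 - u 0 ^ 2|))
    (hts : SeqBox γ t) (htf : MemFlow B gs t) (hprof : ∀ m : ℕ, 1 / ta ^ 2 + bs * (m : ℝ) ≤ 1 / (t m) ^ 2) :
    Tendsto (fun m : ℕ => 1 / ((m : ℝ) * t m ^ 2)) atTop (𝓝 β₀) ∧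
      Tendsto (fun m : ℕ => (1 / t m ^ 2 - (m : ℝ) * β₀) / Real.log (m : ℝ)) atTop (𝓝 (b₁ / β₀)) := by
  obtain ⟨Λ, hΛ⟩ := exists_twoLoopLambda hCm hθ0 hθ1 hC₂ hbs hta h0 h2 hts htf hprof
  exact ⟨tendsto_inv_mul_sq hΛ, tendsto_sub_linear_div_log hΛ⟩

/-- **THE CONSTANT OF THE TWO-LOOP LETTER IS FORCED**: if (T2m) holds with some constant b₀ in place of β₀ (any b₁, C₂), then b₀ IS the value of B at the zero history (test both
moduli on the constant histories γ∕2ⁿ). [folklore] -/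
theorem twoLoop_const_eq_valueAtZero {B : (ℕ → ℝ) → ℝ} {Cm θ γ β₀ b₀ b₁ C₂ : ℝ} (hθ0 : 0 ≤ θ) (hθ1 : θ < 1) (hγ : 0 < γ)
    (h0 : ∀ u : ℕ → ℝ, SeqBox γ u → |B u - β₀| ≤ Cm * ∑' j, θ ^ j * u j)
    (h2 : ∀ u : ℕ → ℝ, SeqBox γ u → |B u - b₀ - b₁ * u 0 ^ 2| ≤ C₂ * ∑' j, θ ^ j * (u j ^ 4 + |u j ^ 2 - u 0 ^ 2|)) : b₀ = β₀ := by
  have h1θ : 0 < 1 - θ := by linarith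
  set c : ℕ → ℝ := fun n => γ * (1 / 2) ^ n with hc
  have hc0 : ∀ n, 0 < c n := fun n => by positivity
  have hcγ : ∀ n, c n ≤ γ := fun n => by
    have : ((1 : ℝ) / 2) ^ n ≤ 1 := pow_le_one₀ (by norm_num) (by norm_num)
    simpa [hc] using mul_le_of_le_one_right hγ.le this
  have hcbox : ∀ n, SeqBox γ (fun _ : ℕ => c n) := fun n _ => ⟨hc0 n, hcγ n⟩
  have hgeom : ∀ a : ℝ, ∑' j : ℕ, θ ^ j * a = a / (1 - θ) := fun a => by
    rw [tsum_mul_right, tsum_geometric_of_lt_one hθ0 hθ1]; ring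
  -- on the constant history c n: |b₀ − β₀| ≤ Cm c∕(1−θ) + C₂ c⁴∕(1−θ) + |b₁| c²
  have hbound : ∀ n, |b₀ - β₀| ≤ Cm * (c n / (1 - θ)) + C₂ * (c n ^ 4 / (1 - θ)) + |b₁| * c n ^ 2 := by
    intro n
    have hA := h0 _ (hcbox n)
    have hB := h2 _ (hcbox n)
    simp only [sub_self, abs_zero, add_zero] at hB
    rw [hgeom] at hA hB
    have hb1 : |b₁ * c n ^ 2| = |b₁| * c n ^ 2 := by rw [abs_mul, abs_of_nonneg (pow_nonneg (hc0 n).le 2)]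
    calc |b₀ - β₀| = |(B (fun _ => c n) - β₀) + -(B (fun _ => c n) - b₀ - b₁ * c n ^ 2) + -(b₁ * c n ^ 2)| := by ring_nf
      _ ≤ |B (fun _ => c n) - β₀| + |-(B (fun _ => c n) - b₀ - b₁ * c n ^ 2)| + |-(b₁ * c n ^ 2)| := abs_add_three _ _ _
      _ = |B (fun _ => c n) - β₀| + |B (fun _ => c n) - b₀ - b₁ * c n ^ 2| + |b₁ * c n ^ 2| := by rw [abs_neg, abs_neg]
      _ ≤ _ := by rw [hb1]; linarith
  have hc_lim : Tendsto c atTop (𝓝 0) := by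
    have := (tendsto_pow_atTop_nhds_zero_of_lt_one (by norm_num : (0 : ℝ) ≤ 1 / 2) (by norm_num)).const_mul γ
    simpa [hc] using this
  have herr : Tendsto (fun n => Cm * (c n / (1 - θ)) + C₂ * (c n ^ 4 / (1 - θ)) + |b₁| * c n ^ 2) atTop
      (𝓝 (Cm * (0 / (1 - θ)) + C₂ * (0 ^ 4 / (1 - θ)) + |b₁| * 0 ^ 2)) :=
    (((hc_lim.div_const _).const_mul _).add (((hc_lim.pow 4).div_const _).const_mul _)).add ((hc_lim.pow 2).const_mul _)
  have h := le_of_tendsto_of_tendsto' tendsto_const_nhds herr hbound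
  have h0' : Cm * (0 / (1 - θ)) + C₂ * ((0 : ℝ) ^ 4 / (1 - θ)) + |b₁| * (0 : ℝ) ^ 2 = 0 := by simp
  rw [h0'] at h
  exact eq_of_abs_sub_nonpos h

end

end Summit.QuantumFields.BalabanUV.Beta.EriceFlowEnclosureB12AsPrintedHistoryContagionShiftFlowZeroTwoLoop
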